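import Summits.ResolutionOfSingularities.ResolutionOfSingularities.Theorems.WeightedInvariantLocalWeightedDropTrackCChartFrame
import Summits.ResolutionOfSingularities.ResolutionOfSingularities.Theorems.WeightedInvariantLocalWeightedDropTrackCOffCentre
import Summits.ResolutionOfSingularities.ResolutionOfSingularities.Theorems.WeightedInvariantLocalWeightedDropTrackCForward
import Summits.ResolutionOfSingularities.ResolutionOfSingularities.Theorems.WeightedInvariantLocalWeightedDropTameSuccessor
import Summits.ResolutionOfSingularities.ResolutionOfSingularities.Theorems.WeightedInvariantLocalWeightedDropSliceChart
import Summits.ResolutionOfSingularities.ResolutionOfSingularities.Theorems.WeightedInvariantGlobalizeLocalDropRegularGerms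
import Literature.AlgebraicGeometry.Resolution.CanonicalResolutionSmoothCentre
import Literature.AlgebraicGeometry.Resolution.PointBlowupHsFunMono
import Literature.AlgebraicGeometry.Resolution.MarkedIdeals

/-!
# Track C, the blow-up step: `WonAt f (τ ≫ σ) → WonAt f σ`

[OURS · L1 W4.3 · chain w43, stub worker 4] Helper for TRACK C of the engine crux `LocalWeightedDrop`
(stmt-ResolutionOfSingularities-8899; skeleton `L/res-L1-w43-stub-4/TrackC_Skeleton.lean`, lemma L2). NOT a statement
of any manuscript.

`wonAt_of_wonAt_blowup`: for a blow-up `τ : Z'' ⟶ Z'` of an integral locally Noetherian `Z'` along a non-zero centre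
`C` with `C.subscheme` regular, `WonAt f (τ ≫ σ) → WonAt f σ`. Off the centre: `won_of_wonAt_blowup_of_not_mem_support`.
At `z ∈ V(C)`: `C_z` is generated by part `x_l (l < n)` of a regular system of parameters `x` (Matsumura 14.2,
`exists_rsop_of_isRegularLocalRing_quotient`, reindexed as a prefix); in the frame `F'` adapted to `x` (change of frame,
`Frame.exists_subst` + `won_subst_iff`) the Prover plays the move `(X, 𝟙_{l<n})` — the blow-up of `C`; a singular
successor `G` at the exceptional point `c` on the chart `i` (`SliceChart.exists_chart_of_isSuccessor`) is won with its
slice `G|_{yᵢ=0}` (`TameSuccessor.won_successor_of_won_slice`, weight `1` is prime to `p`), and the slice divides the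
total transform read in the Cohen frame at the Refuter's point `x' ∈ Z''` (`exists_frame_square`: the completed
blow-up there IS the restricted chart substitution, `SliceChart.subst_restrictedChart`), so it is won by hypothesis
(or is `0`, which is won: `won_zero`).
-/

noncomputable section

open CategoryTheory CategoryTheory.Limits AlgebraicGeometry TopologicalSpace IsLocalRing
open Literature.AlgebraicGeometry.Resolution
open Literature.RingTheory.MvPowerSeries.Jets
open Scheme.IdealSheafData

set_option linter.dupNamespace false -- mandated namespace of this single-conjunct summit

namespace Summit.ResolutionOfSingularities.ResolutionOfSingularities.Theorems.TrackC

variable {k : Type} [Field k]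

/-! ## Game-side helpers -/

/-- **The zero germ is won** (in `n ≥ 1` variables): no move has a singular successor, since a successor `G`
satisfies `sᵃ·G = 0` and `s ∤ G`. [OURS · folklore] -/
theorem won_zero {n : ℕ} (hn : 0 < n) : CobordantGame.Won k n (0 : MvPowerSeries (Fin n) k) := by
  refine CobordantGame.Won.move MvPowerSeries.X (fun _ => 1)
    ⟨fun i => MvPowerSeries.constantCoeff_X i, ?_, ⟨⟨0, hn⟩, Nat.one_pos⟩⟩ ?_
  · rw [linMat_X_eq_one, Matrix.det_one]; exact isUnit_one
  · rintro G ⟨c, a, -, hfac, hndvd, -⟩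
    exfalso
    apply hndvd
    have hX : MvPowerSeries.HasSubst (MvPowerSeries.X : Fin n → MvPowerSeries (Fin n) k) :=
      MvPowerSeries.hasSubst_of_constantCoeff_zero fun i => MvPowerSeries.constantCoeff_X i
    have hch : MvPowerSeries.HasSubst (CobordantGame.cruxChart k (fun _ : Fin n => 1) c) :=
      MvPowerSeries.hasSubst_of_constantCoeff_zero fun i => constantCoeff_cruxChart _ c i
    rw [← MvPowerSeries.coe_substAlgHom hX, map_zero, ← MvPowerSeries.coe_substAlgHom hch, map_zero] at hfac
    have hG : G = 0 := by
      rcases mul_eq_zero.mp hfac.symm with h | h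
      · exact absurd h (pow_ne_zero _ (MvPowerSeries.X_ne_zero_of_field 0))
      · exact h
    rw [hG]
    exact dvd_zero _

/-- The identity move with weights `𝟙_{l < n}` (`1 ≤ n`) is legal. [OURS · folklore] -/
theorem isMove_X_prefix {n : ℕ} (hn1 : 1 ≤ n) (hn3 : n ≤ 3) :
    CobordantGame.IsMove k (MvPowerSeries.X : Fin 3 → MvPowerSeries (Fin 3) k)
      (fun l : Fin 3 => if (l : ℕ) < n then 1 else 0) := by
  refine ⟨fun i => MvPowerSeries.constantCoeff_X i, ?_, ⟨Fin.castLE hn3 ⟨0, hn1⟩, ?_⟩⟩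
  · rw [linMat_X_eq_one, Matrix.det_one]; exact isUnit_one
  · have h : ((Fin.castLE hn3 ⟨0, hn1⟩ : Fin 3) : ℕ) < n := by simp; omega
    simp only [h, if_true, Nat.one_pos]

/-! ## Ring-side helpers -/

/-- **Prefix reindexing.** A family `u : Fin 3 → O` and a set `S` of indices can be re-enumerated as `x : Fin 3 → O`
with the same range and `x '' {l < n} = u '' S`, `n = #S`. [OURS · folklore] -/
theorem exists_prefix_reindex {O : Type} {d : ℕ} (hd : d = 3) (u : Fin d → O) (S : Set (Fin d)) :
    ∃ (n : ℕ) (hn : n ≤ 3) (x : Fin 3 → O), Set.range x = Set.range u ∧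
      (Set.range fun l : Fin n => x (Fin.castLE hn l)) = u '' S ∧ (S.Nonempty → 1 ≤ n) := by
  classical
  subst hd
  let T : Finset (Fin 3) := S.toFinset
  have hT : ∀ i, i ∈ T ↔ i ∈ S := fun i => Set.mem_toFinset
  have hcard : T.card + Tᶜ.card = 3 := by
    rw [Finset.card_compl, Fintype.card_fin]; have := T.card_le_univ; rw [Fintype.card_fin] at this; omega
  let eS : T ≃ Fin T.card := T.equivFin
  let eC : ↥(Tᶜ) ≃ Fin Tᶜ.card := Tᶜ.equivFin
  have hn3 : T.card ≤ 3 := by omega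
  refine ⟨T.card, hn3, fun l => if h : (l : ℕ) < T.card then u (eS.symm ⟨l, h⟩)
    else u (eC.symm ⟨(l : ℕ) - T.card, by omega⟩), ?_, ?_, ?_⟩
  · apply le_antisymm
    · rintro _ ⟨l, rfl⟩
      by_cases h : (l : ℕ) < T.card
      · simp only [h, dif_pos]; exact ⟨_, rfl⟩
      · simp only [h, dif_neg, not_false_eq_true]; exact ⟨_, rfl⟩
    · rintro _ ⟨i, rfl⟩
      by_cases hi : i ∈ T
      · refine ⟨Fin.castLE hn3 (eS ⟨i, hi⟩), ?_⟩
        have hlt : ((Fin.castLE hn3 (eS ⟨i, hi⟩) : Fin 3) : ℕ) < T.card := by simp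
        simp only [hlt, dif_pos]
        congr 1
        have : (⟨((Fin.castLE hn3 (eS ⟨i, hi⟩) : Fin 3) : ℕ), hlt⟩ : Fin T.card) = eS ⟨i, hi⟩ := Fin.ext (by simp)
        rw [this, Equiv.symm_apply_apply]
      · have hi' : i ∈ Tᶜ := Finset.mem_compl.mpr hi
        refine ⟨⟨T.card + (eC ⟨i, hi'⟩ : ℕ), by have := (eC ⟨i, hi'⟩).2; omega⟩, ?_⟩
        have hnlt : ¬ (T.card + (eC ⟨i, hi'⟩ : ℕ) < T.card) := by omega
        simp only [hnlt, dif_neg, not_false_eq_true]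
        congr 1
        have : (⟨T.card + (eC ⟨i, hi'⟩ : ℕ) - T.card, by have := (eC ⟨i, hi'⟩).2; omega⟩ : Fin Tᶜ.card) =
            eC ⟨i, hi'⟩ := Fin.ext (by simp)
        rw [this, Equiv.symm_apply_apply]
  · apply le_antisymm
    · rintro _ ⟨l, rfl⟩
      have hlt : ((Fin.castLE hn3 l : Fin 3) : ℕ) < T.card := by simp
      simp only [hlt, dif_pos]
      exact ⟨_, (hT _).mp (eS.symm ⟨_, hlt⟩).2, rfl⟩
    · rintro _ ⟨i, hi, rfl⟩
      have hiT : i ∈ T := (hT i).mpr hi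
      refine ⟨eS ⟨i, hiT⟩, ?_⟩
      have hlt : ((Fin.castLE hn3 (eS ⟨i, hiT⟩) : Fin 3) : ℕ) < T.card := by simp
      simp only [hlt, dif_pos]
      congr 1
      have : (⟨((Fin.castLE hn3 (eS ⟨i, hiT⟩) : Fin 3) : ℕ), hlt⟩ : Fin T.card) = eS ⟨i, hiT⟩ := Fin.ext (by simp)
      rw [this, Equiv.symm_apply_apply]
  · rintro ⟨i, hi⟩
    exact Finset.card_pos.mpr ⟨i, (hT i).mpr hi⟩

/-- **Translated generators span the same ideal** (a unimodular change). [OURS · folklore] -/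
theorem span_translated_eq {O : Type} [CommRing O] {n : ℕ} (hn3 : n ≤ 3) (x : Fin 3 → O) (iN : Fin n)
    (t : Fin n → O) (u' : Fin n → O) (hu'i : u' iN = x (Fin.castLE hn3 iN))
    (hu'l : ∀ l, l ≠ iN → u' l = x (Fin.castLE hn3 l) - t l * x (Fin.castLE hn3 iN)) :
    Ideal.span (Set.range u') = Ideal.span (Set.range fun l : Fin n => x (Fin.castLE hn3 l)) := by
  apply le_antisymm
  · rw [Ideal.span_le]
    rintro _ ⟨l, rfl⟩
    by_cases hl : l = iN
    · subst hl; rw [hu'i]; exact Ideal.subset_span ⟨l, rfl⟩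
    · rw [hu'l l hl]
      exact Ideal.sub_mem _ (Ideal.subset_span ⟨l, rfl⟩) (Ideal.mul_mem_left _ _ (Ideal.subset_span ⟨iN, rfl⟩))
  · rw [Ideal.span_le]
    rintro _ ⟨l, rfl⟩
    have hi : x (Fin.castLE hn3 iN) ∈ Ideal.span (Set.range u') := by
      rw [← hu'i]; exact Ideal.subset_span ⟨iN, rfl⟩
    by_cases hl : l = iN
    · subst hl; exact hi
    · have h1 : x (Fin.castLE hn3 l) = u' l + t l * x (Fin.castLE hn3 iN) := by rw [hu'l l hl]; ring
      change x (Fin.castLE hn3 l) ∈ Ideal.span (Set.range u')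
      rw [h1]
      exact Ideal.add_mem _ (Ideal.subset_span ⟨l, rfl⟩) (Ideal.mul_mem_left _ _ hi)

/-- The coordinates split into the centre coordinates `l < n` and the rest. [OURS · folklore] -/
theorem range_eq_union_prefix {O : Type} {n m : ℕ} (hnm : n + m = 3) (x : Fin 3 → O) :
    Set.range x = (Set.range fun l : Fin n => x (Fin.castLE (by omega) l)) ∪
      Set.range fun j : Fin m => x ⟨n + j, by omega⟩ := by
  apply le_antisymm
  · rintro _ ⟨l, rfl⟩
    by_cases hl : (l : ℕ) < n
    · exact Or.inl ⟨⟨l, hl⟩, rfl⟩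
    · refine Or.inr ⟨⟨(l : ℕ) - n, by omega⟩, ?_⟩
      have h : (⟨n + ((⟨(l : ℕ) - n, by omega⟩ : Fin m) : ℕ), by omega⟩ : Fin 3) = l :=
        Fin.ext (Nat.add_sub_cancel' (not_lt.mp hl))
      simp only [h]
  · rintro _ (⟨l, rfl⟩ | ⟨j, rfl⟩)
    · exact ⟨_, rfl⟩
    · exact ⟨_, rfl⟩

/-- The local ring of the regular closed subscheme `V(C)` at `z ∈ V(C)` is `𝒪_{Z',z}/C_z`, which is therefore regular.
[OURS · folklore] -/
theorem isRegularLocalRing_quotient_of_isRegular_subscheme {Z' : Scheme.{0}} (C : Z'.IdealSheafData)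
    (hreg : Scheme.IsRegular C.subscheme) {z : Z'} (hz : z ∈ C.support) :
    IsRegularLocalRing ((Z'.presheaf.stalk z) ⧸ stalkIdeal C z) := by
  have hz' : z ∈ Set.range C.subschemeι := by rw [Scheme.IdealSheafData.range_subschemeι]; exact hz
  obtain ⟨s, hs⟩ := hz'
  subst hs
  exact (isRegularLocalRing_stalk_subscheme_iff C s).mp (hreg s)

/-! ## The step -/

/-- The total transform at a point of the blow-up is the image of the total transform below under the stalk map.
[OURS · folklore] -/
theorem totalGerm_comp {Z' Z'' : Scheme.{0}} (σ : Z' ⟶ Spec (.of (MvPowerSeries (Fin 3) k))) (τ : Z'' ⟶ Z')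
    (x' : Z'') (f : MvPowerSeries (Fin 3) k) :
    totalGerm (τ ≫ σ) x' f = (τ.stalkMap x').hom (totalGerm σ (τ x') f) := by
  change (Z''.presheaf.germ ⊤ x' trivial).hom ((τ ≫ σ).appTop.hom _) = _
  rw [Scheme.Hom.comp_appTop, CommRingCat.comp_apply]
  exact (Scheme.Hom.germ_stalkMap_apply τ ⊤ x' trivial _).symm

/-- **THE BLOW-UP STEP (lemma L2 of the Track C skeleton).** For a blow-up `τ : Z'' ⟶ Z'` of an integral locally
Noetherian `Z'`-scheme over `Spec k⟦x₀,x₁,x₂⟧` along a non-zero centre `C` with `V(C)` regular: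
`WonAt f (τ ≫ σ) → WonAt f σ`. See the module docstring. [OURS · folklore] -/
theorem wonAt_of_wonAt_blowup (p : ℕ) (hp : p.Prime) [CharP k p] (f : MvPowerSeries (Fin 3) k)
    {Z' Z'' : Scheme.{0}} (σ : Z' ⟶ Spec (.of (MvPowerSeries (Fin 3) k))) [IsIntegral Z'] [IsLocallyNoetherian Z']
    (C : Z'.IdealSheafData) (τ : Z'' ⟶ Z') (hτ : IsBlowup τ C) (hreg : Scheme.IsRegular C.subscheme) (hC : C ≠ ⊥)
    (h : WonAt f (τ ≫ σ)) : WonAt f σ := by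
  classical
  intro z hN F g hg hs
  by_cases hz : z ∈ C.support
  swap
  · exact won_of_wonAt_blowup_of_not_mem_support f σ C τ hτ h hz hN F g hg hs
  haveI := hN
  haveI := F.isRegularLocalRing
  haveI : IsDomain (MvPowerSeries (Fin 3) k) := NoZeroDivisors.to_isDomain _
  -- the centre at `z`: part of a regular system of parameters
  have hCle : stalkIdeal C z ≤ maximalIdeal _ := (mem_support_iff_stalkIdeal_le C z).mp hz
  haveI := isRegularLocalRing_quotient_of_isRegular_subscheme C hreg hz
  obtain ⟨u, huspan, S, hCS⟩ := exists_rsop_of_isRegularLocalRing_quotient hCle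
  have hd3 : (maximalIdeal (Z'.presheaf.stalk z)).spanFinrank = 3 := by
    have h1 := IsRegularLocalRing.spanFinrank_maximalIdeal (R := Z'.presheaf.stalk z)
    rw [F.ringKrullDim_eq] at h1
    exact_mod_cast h1
  obtain ⟨n, hn3, x, hxr, hxS, hn1⟩ := exists_prefix_reindex hd3 u S
  have hxspan : Ideal.span (Set.range x) = maximalIdeal _ := by rw [hxr, huspan]
  have hCx : stalkIdeal C z = Ideal.span (Set.range fun l : Fin n => x (Fin.castLE hn3 l)) := by
    rw [hCS, hxS]
  replace hn1 : 1 ≤ n := by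
    refine hn1 (Set.nonempty_iff_ne_empty.mpr fun hS => stalkIdeal_ne_bot_of_ne_bot hC z ?_)
    rw [hCS, hS, Set.image_empty, Ideal.span_empty]
  -- change of frame: `F'` adapted to `x`
  obtain ⟨F', hF'⟩ := F.exists_adapted x hxspan
  obtain ⟨φ, hφ0, hφdet, hφe⟩ := Frame.exists_subst F F'
  have hφs : MvPowerSeries.HasSubst φ := MvPowerSeries.hasSubst_of_constantCoeff_zero hφ0
  rw [← won_subst_iff hφ0 hφdet g]
  have hg' : MvPowerSeries.subst φ g ∣ F'.e (algebraMap _ _ (totalGerm σ z f)) := by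
    rw [hφe, ← MvPowerSeries.coe_substAlgHom hφs]
    exact map_dvd _ hg
  obtain ⟨M, hM⟩ := hg'
  -- THE MOVE: the blow-up of the centre, `(X, 𝟙_{l<n})`
  refine CobordantGame.Won.move MvPowerSeries.X (fun l : Fin 3 => if (l : ℕ) < n then 1 else 0)
    (isMove_X_prefix hn1 hn3) fun G hG => ?_
  -- a singular successor `G` at the exceptional point `cv` on the chart `i'`
  obtain ⟨-, -, -, -, -, hG0, hG1⟩ := id hG
  obtain ⟨cv, a, ⟨i', hwi', hci'⟩, hcw, hfac, -⟩ := SliceChart.exists_chart_of_isSuccessor hG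
  have hi'n : ((i' : Fin 3) : ℕ) < n := by
    by_contra hc
    simp [hc] at hwi'
  obtain ⟨iN, rfl⟩ : ∃ iN : Fin n, Fin.castLE hn3 iN = i' := ⟨⟨i', hi'n⟩, Fin.ext rfl⟩
  have hcv : ∀ l : Fin 3, n ≤ (l : ℕ) → cv l = 0 := fun l hl => hcw l (by simp [not_lt.mpr hl])
  have hpw : ¬ p ∣ (fun l : Fin 3 => if (l : ℕ) < n then 1 else 0) (Fin.castLE hn3 iN) := by
    have hlt : ((Fin.castLE hn3 iN : Fin 3) : ℕ) < n := by simp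
    simp only [hlt, if_true]
    exact hp.not_dvd_one
  refine TameSuccessor.won_successor_of_won_slice p hp (MvPowerSeries.subst φ g) _ cv hcw a G hfac
    (Fin.castLE hn3 iN) hci' hpw ?_
  -- the slice `Sl = G|_{y_i = 0}`
  have hslice := SliceChart.subst_restrictedChart (fun l : Fin 3 => if (l : ℕ) < n then 1 else 0) cv hcw
    (MvPowerSeries.subst φ g) a G hfac (Fin.castLE hn3 iN)
  have hsl0 : ∀ j : Fin 4, MvPowerSeries.constantCoeff ((fun j : Fin 4 => if j = (Fin.castLE hn3 iN).succ then
      (0 : MvPowerSeries (Fin 3) k) else MvPowerSeries.X (Fin.predAbove (Fin.castLE hn3 iN) j)) j) = 0 := by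
    intro j
    by_cases hj : j = (Fin.castLE hn3 iN).succ
    · simp [hj]
    · simp [hj, MvPowerSeries.constantCoeff_X]
  by_cases hSl0 : MvPowerSeries.subst (fun j : Fin 4 => if j = (Fin.castLE hn3 iN).succ then
      (0 : MvPowerSeries (Fin 3) k) else MvPowerSeries.X (Fin.predAbove (Fin.castLE hn3 iN) j)) G = 0
  · rw [hSl0]; exact won_zero (by norm_num)
  have hSl2 := FormalCoordChange.two_le_order_subst _ hsl0 G ((FormalCoordChange.two_le_order_iff G).mpr ⟨hG0, hG1⟩)
  have hSls : CobordantGame.IsSingular k (MvPowerSeries.subst (fun j : Fin 4 =>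
      if j = (Fin.castLE hn3 iN).succ then (0 : MvPowerSeries (Fin 3) k)
      else MvPowerSeries.X (Fin.predAbove (Fin.castLE hn3 iN) j)) G) :=
    ⟨hSl0, ((FormalCoordChange.two_le_order_iff _).mp hSl2).1, ((FormalCoordChange.two_le_order_iff _).mp hSl2).2⟩
  -- the Refuter's point: translated generators, chart ring map, prime, point
  obtain ⟨u', hu'⟩ : ∃ u' : Fin n → Z'.presheaf.stalk z, u' = fun l => if l = iN then x (Fin.castLE hn3 iN)
      else x (Fin.castLE hn3 l) - stalkConst σ z (cv (Fin.castLE hn3 l) / cv (Fin.castLE hn3 iN)) *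
        x (Fin.castLE hn3 iN) := ⟨_, rfl⟩
  have hu'i : u' iN = x (Fin.castLE hn3 iN) := by rw [hu']; simp
  have hu'l : ∀ l, l ≠ iN → u' l = x (Fin.castLE hn3 l) -
      stalkConst σ z (cv (Fin.castLE hn3 l) / cv (Fin.castLE hn3 iN)) * x (Fin.castLE hn3 iN) := by
    intro l hl; rw [hu']; simp [hl]
  have hu'span : Ideal.span (Set.range u') = stalkIdeal C z := by
    rw [hCx]; exact span_translated_eq hn3 x iN _ u' hu'i hu'l
  obtain ⟨χ, hχb, hχe, hχm⟩ := exists_chartHom F' x hF' hn3 cv iN hci' hcv u' hu'i hu'l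
  let w𝔴 : Spec (.of (chartRing u' iN)) := ⟨Ideal.comap χ (maximalIdeal _), Ideal.IsPrime.comap _⟩
  have hw : w𝔴.asIdeal.comap (chartBase u' iN) = maximalIdeal _ := by
    change (Ideal.comap χ _).comap _ = _
    rw [Ideal.comap_comap]; exact hχm
  obtain ⟨x', q, hx'z, hqw, hiso, hsq⟩ := IsBlowup.exists_point_of_chart hτ z u' hu'span iN w𝔴 hw
  subst hx'z
  -- the Cohen frame at `x'` and the formal square
  have hnm : n + (3 - n) = 3 := by omega
  obtain ⟨wv, hwv'⟩ : ∃ wv : Fin (3 - n) → Z'.presheaf.stalk (τ x'),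
      wv = fun j : Fin (3 - n) => x ⟨n + (j : ℕ), by have := j.2; omega⟩ := ⟨_, rfl⟩
  have hwv : ∀ j : Fin (3 - n), wv j = x ⟨n + (j : ℕ), by have := j.2; omega⟩ := fun j => by rw [hwv']
  have hz : Ideal.span (Set.range (Fin.append u' wv)) = maximalIdeal _ := by
    rw [range_fin_append, Ideal.span_union, hu'span, hCx, ← Ideal.span_union, ← hxspan,
      range_eq_union_prefix hnm x, hwv']
  obtain ⟨hN'', F'', hsqr⟩ := exists_frame_square σ C τ hτ x' F' x hF' hnm cv iN hci' hcv u' hu'i hu'l wv hwv hz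
    χ hχb hχe w𝔴 rfl q hqw hiso hsq
  -- the slice divides the total transform in the frame `F''`
  refine h x' hN'' F'' _ ?_ hSls
  have hρs : MvPowerSeries.HasSubst (fun l : Fin 3 => (MvPowerSeries.X 0 : MvPowerSeries (Fin 3) k) ^
      (if (l : ℕ) < n then 1 else 0) * (MvPowerSeries.C (cv l) + if l = Fin.castLE hn3 iN then
        (0 : MvPowerSeries (Fin 3) k) else MvPowerSeries.X (Fin.predAbove (Fin.castLE hn3 iN) l.succ))) :=
    MvPowerSeries.hasSubst_of_constantCoeff_zero (constantCoeff_rchart cv _ n hcv)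
  have hT'' : F''.e (algebraMap _ _ (totalGerm (τ ≫ σ) x' f)) =
      MvPowerSeries.subst (fun l : Fin 3 => (MvPowerSeries.X 0 : MvPowerSeries (Fin 3) k) ^
        (if (l : ℕ) < n then 1 else 0) * (MvPowerSeries.C (cv l) + if l = Fin.castLE hn3 iN then
          (0 : MvPowerSeries (Fin 3) k) else MvPowerSeries.X (Fin.predAbove (Fin.castLE hn3 iN) l.succ)))
        (F'.e (algebraMap _ _ (totalGerm σ (τ x') f))) := by
    have hof : ∀ b : Z'.presheaf.stalk (τ x'), DeJong1996.completedStalkMap τ x' (algebraMap _ _ b) =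
        algebraMap (Z''.presheaf.stalk x') _ ((τ.stalkMap x').hom b) := fun b => DeJong1996.completedStalkMap_of τ x' b
    rw [totalGerm_comp, ← hof]
    exact hsqr _
  have hslice' : MvPowerSeries.subst (fun l : Fin 3 => (MvPowerSeries.X 0 : MvPowerSeries (Fin 3) k) ^
      (if (l : ℕ) < n then 1 else 0) * (MvPowerSeries.C (cv l) + if l = Fin.castLE hn3 iN then
        (0 : MvPowerSeries (Fin 3) k) else MvPowerSeries.X (Fin.predAbove (Fin.castLE hn3 iN) l.succ)))
      (MvPowerSeries.subst φ g) = MvPowerSeries.X 0 ^ a * MvPowerSeries.subst (fun j : Fin 4 =>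
        if j = (Fin.castLE hn3 iN).succ then (0 : MvPowerSeries (Fin 3) k)
        else MvPowerSeries.X (Fin.predAbove (Fin.castLE hn3 iN) j)) G := hslice
  rw [hT'', hM, MvPowerSeries.subst_mul hρs, hslice']
  exact ⟨MvPowerSeries.X 0 ^ a * MvPowerSeries.subst _ M, by ring⟩

end Summit.ResolutionOfSingularities.ResolutionOfSingularities.Theorems.TrackC

end
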